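import Summits.Ventures.AbcSig.Conjectures.KrausTableSemantics

/-!
# Venture AbcSig — the computable Kraus tables REFINE the coarse [BS04, Lemma 4.2] list: `krausTable … q ⊆ bs04Allowed q`

HONEST FRAMING. Support file of the computation cell `pub-abcsig`; unconditional facts about the computable generator
`Recipes/KrausTable.lean`. No Diophantine statement, no hypothesis, no claim on ABC or any summit.

WHAT IS PROVED. For a prime `q ≥ 5` with `q ∤ B·C` (any `A`, any model `μ ∈ {E₁, E₂, E₃}`, any exponent `n`):
* `mem_krausTable_iff`-type bookkeeping (`mem_insertSorted`, `mem_foldl_insertSorted`): an element of `krausTable μ A B C n q` is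
  `±(q + 1)` or the trace `traceNaive q a₂ a₄` of one of the enumerated curves;
* `isElliptic_of_enumerated` — every enumerated curve `Y² = X³ + a₂X² + a₄X` is ELLIPTIC over `ZMod q`: `Δ = 16·a₄²·(a₂² − 4a₄)`
  with `a₄ = BCu·(unit)` nonzero and `a₂² − 4a₄ = (unit)·C·(Cc² − Bu)` nonzero because the generator only keeps `(u, c)` with
  `aⁿ = (Cc² − Bu)/A ≢ 0`;
* `krausTable_subset_bs04Allowed` — hence (by `traceNaive_mem_bs04Allowed` of `Conjectures/KrausTableSemantics.lean`: even + Hasse)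
  every entry lies in `bs04Allowed q`;
* `NewformModel.arisesMod_mono`, `arisesMod_bs04_of_krausTableAt` — so "passes the Kraus table" implies "passes the coarse sieve":
  `M.ArisesMod f n (krausTableAt μ A B C n aux) → M.ArisesMod f n bs04Allowed` whenever the auxiliary primes are `≥ 5` and prime to `BC`.
This is decision D6 of the `CONJ_LR32_L2″` draft (HOME/plean/g7/CONJ-LR32-L2-DRAFT-g7.md) as a theorem.
-/

namespace Summit.Ventures.AbcSig.Conjectures

open Summit.Ventures.AbcSig

/-! ## List bookkeeping for the generator's output -/

/-- Membership in `insertSorted`. -/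
theorem mem_insertSorted {x t : ℤ} {l : List ℤ} : x ∈ insertSorted t l ↔ x = t ∨ x ∈ l := by
  induction l with
  | nil => simp [insertSorted]
  | cons s rest ih =>
    simp only [insertSorted]
    split_ifs with h1 h2
    · simp
    · subst h2; simp
    · simp only [List.mem_cons, ih]; tauto

/-- Membership in an `insertSorted` fold. -/
theorem mem_foldl_insertSorted {x : ℤ} (l acc : List ℤ) :
    x ∈ l.foldl (fun acc t => insertSorted t acc) acc ↔ x ∈ l ∨ x ∈ acc := by
  induction l generalizing acc with
  | nil => simp
  | cons t rest ih =>
    simp only [List.foldl_cons, ih, mem_insertSorted, List.mem_cons]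
    tauto

/-- What an element of `krausTable μ A B C n q` is: `±(q + 1)`, or the trace of an enumerated curve — some `u` in the list of
nonzero `n`-th power residues and some `c < q` with `aⁿ := (Cc² − Bu)·A⁻¹ mod q` nonzero (and an `n`-th power residue). -/
theorem mem_krausTable {μ : FreyModel} {A B C n q : ℕ} {t : ℤ} (ht : t ∈ krausTable μ A B C n q) :
    t = -((q : ℤ) + 1) ∨ t = (q : ℤ) + 1 ∨
      ∃ u ∈ nthPowerResidues q n, ∃ c < q,
        (C * c * c % q + q - B * u % q) % q * invModP q A % q ≠ 0 ∧
        t = traceNaive q (μ.coeffs q B C u c).1 (μ.coeffs q B C u c).2 := by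
  unfold krausTable at ht
  simp only at ht
  rw [mem_foldl_insertSorted] at ht
  rcases ht with ht | ht
  · right; right
    simp only [List.mem_flatMap, List.mem_filterMap, List.mem_range] at ht
    obtain ⟨u, hu, c, hc, h⟩ := ht
    split_ifs at h with hcond
    · refine ⟨u, hu, c, hc, hcond.1, ?_⟩
      simpa using (Option.some.inj h).symm
  · simp only [List.mem_cons, List.not_mem_nil, or_false] at ht
    rcases ht with h | h
    · exact Or.inl h
    · exact Or.inr (Or.inl h)

/-! ## The enumerated curves are elliptic -/

/-- Elements of `nthPowerResidues q n` are nonzero residues `< q` (`q` prime). -/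
theorem nthPowerResidues_ne_zero {q n u : ℕ} (hq : q.Prime) (hu : u ∈ nthPowerResidues q n) : (u : ZMod q) ≠ 0 := by
  unfold nthPowerResidues at hu
  rw [List.mem_dedup, List.mem_map] at hu
  obtain ⟨x, hx, rfl⟩ := hu
  rw [List.mem_filter, List.mem_range] at hx
  obtain ⟨hxq, hx0⟩ := hx
  have hx0' : x ≠ 0 := by simpa using hx0
  intro h
  rw [ZMod.natCast_mod, ZMod.natCast_eq_zero_iff] at h
  have hqx : q ∣ x := hq.dvd_of_dvd_pow h
  exact absurd (Nat.le_of_dvd (Nat.pos_of_ne_zero hx0') hqx) (by omega)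

/-- `Δ` of `Y² = X³ + a₂X² + a₄X` is `16·a₄²·(a₂² − 4a₄)`. -/
theorem Δ_of_a₁_a₃_a₆_zero {F : Type*} [CommRing F] (E : WeierstrassCurve F) (h₁ : E.a₁ = 0) (h₃ : E.a₃ = 0)
    (h₆ : E.a₆ = 0) : E.Δ = 16 * E.a₄ ^ 2 * (E.a₂ ^ 2 - 4 * E.a₄) := by
  simp only [WeierstrassCurve.Δ, WeierstrassCurve.b₂, WeierstrassCurve.b₄, WeierstrassCurve.b₆, WeierstrassCurve.b₈, h₁, h₃, h₆]
  ring

/-- The residue `(Cc² − Bu) mod q` computed in `ℕ` as the generator does. -/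
theorem cast_sub_residue {q : ℕ} [NeZero q] (B C u c : ℕ) :
    (((C * c * c % q + q - B * u % q) % q : ℕ) : ZMod q) = (C : ZMod q) * c * c - (B : ZMod q) * u := by
  have hle : B * u % q ≤ C * c * c % q + q := le_add_left (Nat.mod_lt _ (NeZero.pos q)).le
  rw [ZMod.natCast_mod, Nat.cast_sub hle]
  push_cast
  rw [ZMod.natCast_mod, ZMod.natCast_self, ZMod.natCast_mod]
  push_cast
  ring

/-- If the generator keeps `(u, c)` (its `aⁿ` residue is nonzero) then `Cc² − Bu ≢ 0 (mod q)`. -/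
theorem sub_ne_zero_of_kept {q : ℕ} [NeZero q] {A B C u c : ℕ}
    (h : (C * c * c % q + q - B * u % q) % q * invModP q A % q ≠ 0) :
    (C : ZMod q) * c * c - (B : ZMod q) * u ≠ 0 := by
  intro h0
  apply h
  have hres : (C * c * c % q + q - B * u % q) % q = 0 := by
    have := cast_sub_residue (q := q) B C u c
    rw [h0, ZMod.natCast_eq_zero_iff] at this
    exact Nat.eq_zero_of_dvd_of_lt this (Nat.mod_lt _ (NeZero.pos q))
  rw [hres, zero_mul, Nat.zero_mod]

/-- `a · invModP q a ≡ 1 (mod q)` for a prime `q ∤ a` (Fermat). -/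
theorem mul_invModP {q a : ℕ} [Fact q.Prime] (ha : (a : ZMod q) ≠ 0) :
    (a : ZMod q) * (invModP q a : ℕ) = 1 := by
  unfold invModP
  rw [ZMod.natCast_mod, Nat.cast_pow, ← pow_succ', show q - 2 + 1 = q - 1 from by
    have := (Fact.out : q.Prime).two_le; omega]
  exact ZMod.pow_card_sub_one_eq_one ha

/-- The curve the generator attaches to a kept pair `(u, c)`: `⟨0, a₂, 0, a₄, 0⟩` over `ZMod q`. -/
def enumCurve (μ : FreyModel) (q B C u c : ℕ) : WeierstrassCurve (ZMod q) :=
  ⟨0, ((μ.coeffs q B C u c).1 : ZMod q), 0, ((μ.coeffs q B C u c).2 : ZMod q), 0⟩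

/-- **Every enumerated curve is elliptic** (`q` prime, `q ∤ 2BC`, `u` a nonzero residue, the pair kept). -/
theorem isElliptic_enumCurve (μ : FreyModel) {q A B C u c : ℕ} [Fact q.Prime] (hq2 : q ≠ 2)
    (hB : (B : ZMod q) ≠ 0) (hC : (C : ZMod q) ≠ 0) (hu : (u : ZMod q) ≠ 0)
    (hkept : (C * c * c % q + q - B * u % q) % q * invModP q A % q ≠ 0) :
    (enumCurve μ q B C u c).IsElliptic := by
  have h2 : (2 : ZMod q) ≠ 0 := Ring.two_ne_zero (show ringChar (ZMod q) ≠ 2 by rw [ZMod.ringChar_zmod_n]; exact hq2)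
  have h4 : (4 : ZMod q) ≠ 0 := by
    rw [show (4 : ZMod q) = 2 * 2 by norm_num]; exact mul_ne_zero h2 h2
  have h64 : ((64 : ℕ) : ZMod q) ≠ 0 := by
    rw [show ((64 : ℕ) : ZMod q) = 2 ^ 6 by norm_num]; exact pow_ne_zero _ h2
  have h4' : ((4 : ℕ) : ZMod q) ≠ 0 := by rw [Nat.cast_ofNat]; exact h4
  have hi4 := mul_invModP (q := q) h4'
  have hi64 := mul_invModP (q := q) h64
  rw [Nat.cast_ofNat] at hi4 hi64
  have hsub := sub_ne_zero_of_kept (q := q) (A := A) hkept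
  rw [WeierstrassCurve.isElliptic_iff, Δ_of_a₁_a₃_a₆_zero _ rfl rfl rfl, isUnit_iff_ne_zero]
  have h16 : (16 : ZMod q) ≠ 0 := by
    rw [show (16 : ZMod q) = 4 * 4 by norm_num]; exact mul_ne_zero h4 h4
  cases μ with
  | E1 =>
    simp only [enumCurve, FreyModel.coeffs, ZMod.natCast_mod, Nat.cast_mul, Nat.cast_ofNat]
    refine mul_ne_zero (mul_ne_zero h16 (pow_ne_zero _ (mul_ne_zero (mul_ne_zero hB hC) hu))) ?_
    have : (2 * (c : ZMod q) * C) ^ 2 - 4 * ((B : ZMod q) * C * u) = 4 * C * ((C : ZMod q) * c * c - B * u) := by ring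
    rw [this]
    exact mul_ne_zero (mul_ne_zero h4 hC) hsub
  | E2 =>
    simp only [enumCurve, FreyModel.coeffs, ZMod.natCast_mod, Nat.cast_mul]
    set i4 : ZMod q := ((invModP q 4 : ℕ) : ZMod q) with hi4def
    have hi4ne : i4 ≠ 0 := fun h => by rw [h, mul_zero] at hi4; exact zero_ne_one hi4
    refine mul_ne_zero (mul_ne_zero h16 (pow_ne_zero _
      (mul_ne_zero (mul_ne_zero (mul_ne_zero hB hC) hu) hi4ne))) ?_
    have : ((c : ZMod q) * C) ^ 2 - 4 * ((B : ZMod q) * C * u * i4) = C * ((C : ZMod q) * c * c - B * u) := by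
      linear_combination (-(B : ZMod q) * C * u) * hi4
    rw [this]
    exact mul_ne_zero hC hsub
  | E3 =>
    simp only [enumCurve, FreyModel.coeffs, ZMod.natCast_mod, Nat.cast_mul]
    set i4 : ZMod q := ((invModP q 4 : ℕ) : ZMod q) with hi4def
    set i64 : ZMod q := ((invModP q 64 : ℕ) : ZMod q) with hi64def
    have hi64ne : i64 ≠ 0 := fun h => by rw [h, mul_zero] at hi64; exact zero_ne_one hi64
    refine mul_ne_zero (mul_ne_zero h16 (pow_ne_zero _
      (mul_ne_zero (mul_ne_zero (mul_ne_zero hB hC) hu) hi64ne))) ?_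
    intro h0
    have key : (16 : ZMod q) * (((c : ZMod q) * C * i4) ^ 2 - 4 * ((B : ZMod q) * C * u * i64)) =
        C * ((C : ZMod q) * c * c - B * u) := by
      linear_combination ((c : ZMod q) ^ 2 * C ^ 2 * (4 * i4 + 1)) * hi4 - ((B : ZMod q) * C * u) * hi64
    rw [h0, mul_zero] at key
    exact mul_ne_zero hC hsub key.symm

/-! ## The refinement theorem and its consequence for `ArisesMod` -/

/-- **`krausTable μ A B C n q ⊆ bs04Allowed q`** for every prime `q ≥ 5` with `q ∤ B`, `q ∤ C` (any `A`, `μ`, `n`). -/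
theorem krausTable_subset_bs04Allowed (μ : FreyModel) {A B C n q : ℕ} (hq : q.Prime) (hq2 : q ≠ 2) (hq3 : q ≠ 3)
    (hB : ¬ q ∣ B) (hC : ¬ q ∣ C) : ∀ t ∈ krausTable μ A B C n q, t ∈ bs04Allowed q := by
  haveI : Fact q.Prime := ⟨hq⟩
  intro t ht
  rcases mem_krausTable ht with rfl | rfl | ⟨u, hu, c, -, hkept, rfl⟩
  · exact (mem_bs04Allowed_iff q _).mpr (Or.inr (by simp; omega))
  · exact (mem_bs04Allowed_iff q _).mpr (Or.inr (by omega))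
  · have hB' : (B : ZMod q) ≠ 0 := fun h => hB ((ZMod.natCast_eq_zero_iff B q).mp h)
    have hC' : (C : ZMod q) ≠ 0 := fun h => hC ((ZMod.natCast_eq_zero_iff C q).mp h)
    have hu' := nthPowerResidues_ne_zero hq hu
    haveI := isElliptic_enumCurve μ (A := A) hq2 hB' hC' hu' hkept
    exact traceNaive_mem_bs04Allowed hq2 hq3 _ _ (enumCurve μ q B C u c) rfl rfl rfl rfl rfl

/-- `ArisesMod` is monotone in the table at the primes it quantifies over. -/
theorem _root_.Summit.Ventures.AbcSig.NewformModel.arisesMod_mono (M : NewformModel) {N : ℕ} (f : M.Form N) (n : ℕ)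
    {A A' : ℕ → List ℤ} (hAA' : ∀ ℓ : ℕ, ℓ.Prime → ℓ ≠ 2 → ℓ ≠ n → ¬ ℓ ∣ N → ∀ t ∈ A ℓ, t ∈ A' ℓ)
    (h : M.ArisesMod f n A) : M.ArisesMod f n A' := by
  obtain ⟨k, hk, hchar, ψ, hψ⟩ := h
  refine ⟨k, hk, hchar, ψ, fun ℓ hℓ h2 hn hN => ?_⟩
  obtain ⟨t, ht, hψt⟩ := hψ ℓ hℓ h2 hn hN
  exact ⟨t, hAA' ℓ hℓ h2 hn hN t ht, hψt⟩

/-- **Passing a Kraus table implies passing the coarse sieve**: if every auxiliary prime is `≥ 5` and prime to `B·C`, then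
`M.ArisesMod f n (krausTableAt μ A B C n aux) → M.ArisesMod f n bs04Allowed`. -/
theorem arisesMod_bs04_of_krausTableAt (M : NewformModel) {N : ℕ} (f : M.Form N) (n : ℕ) (μ : FreyModel)
    {A B C : ℕ} {aux : List ℕ} (haux : ∀ q ∈ aux, q ≠ 3 ∧ ¬ q ∣ B ∧ ¬ q ∣ C)
    (h : M.ArisesMod f n (krausTableAt μ A B C n aux)) : M.ArisesMod f n bs04Allowed := by
  refine M.arisesMod_mono f n (fun ℓ hℓ h2 _ _ t ht => ?_) h
  unfold krausTableAt at ht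
  split_ifs at ht with hmem
  · obtain ⟨h3, hB, hC⟩ := haux ℓ hmem
    exact krausTable_subset_bs04Allowed μ hℓ h2 h3 hB hC t ht
  · exact ht

end Summit.Ventures.AbcSig.Conjectures
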